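/-
Copyright (c) 2026 the pub-hodgecm-mathlib formalisation cell (harness21).  Prover seat hodgecm-mathlib-K2E3-p08 (g0),
Track B «K2-LIT» ∕ h413, unit U4 «Keys» of the line `K2_E3_EllipticInputs`, file #8: payment of the socket
`K2E3EllipticInputs.U4Keys.sig_K2E3IntertwinerCompositionScalar` — `End_G(i_G(χ)) = ℂ` FOR A REGULAR CHARACTER `χ` OF THE
DIAGONAL TORUS OF `U(Φ₃)(L⁺_v)`: every composition `i_G(χ) → i_G(wχ) → i_G(χ)` of intertwining maps is a scalar.  2026-09-03.
-/
import Summits.HodgeConjecture.HodgeConjecture.Theorems.F0P2pCmPrincipalSeriesInterface          -- ★ p829948: `isSmooth_cmPrincipalSeries`, Frobenius uniqueness `intertwiningMap_cmPrincipalSeries_eq_smul`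
import Summits.HodgeConjecture.HodgeConjecture.Theorems.F0P2pWeylConstituentsRankOne             -- ★ p828796: `id_ne_zero_of_nontrivial_coinvariants`; brings ★ `F0P2pEigenlineFunctionals.intertwiningMap_character_eq_smul`
import Summits.HodgeConjecture.HodgeConjecture.Theorems.F0P3U3PrincipalSeriesJacquetFiltrationHolds  -- ★ p832625: N1 `U3PrincipalSeriesJacquetFiltration_holds` (hypothesis-free)
import Literature.NumberTheory.Automorphic.U3PrincipalSeriesJacquetFiltrationFullUnfold          -- ★ p831282: N1 as a theorem-world `Iff`
import HarnessLib

/-!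
# K2_E3 road (h413 = stmt-HodgeConjecture-24833), unit U4 «Keys», file #8: `End_G(i_G(χ)) = ℂ` for a regular character `χ` —
# every composition `i_G(χ) → i_G(wχ) → i_G(χ)` of intertwining maps is a scalar

Cell `pub/hodgecm-mathlib` (D-0151), Track B (21-frontier RULING «PUSH BOTH» 2026-09-03, director req624, chair K2-lead ORDER #1 ∕ #2, naming rule
s1813), socket module `Summits/HodgeConjecture/HodgeConjecture/Cruxes/H413/Lines/K2_E3_EllipticInputsSigs_U4Keys.lean` (planner K2E3-plan (g0),
SIGS TABLE `K2/K2E3-plan/g0/SIGS-TABLE.K2E3-plan-g0.md` row #8), socket **`sig_K2E3IntertwinerCompositionScalar`** (size M, first rung «yes», all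
inputs ★): for `G = U(Φ₃)(L⁺_v)` at a finite place `v` of `L⁺` NON-SPLIT in the CM field `L`, continuous characters `χ₁` of `L_v^×` and `χ₂` of
`E¹_v`, and the pair `χ = (χ₁, χ₂)` of the diagonal torus `T` REGULAR (`χ ≠ wχ = (χ̄₁⁻¹, χ₂)`, ★ `cmTorusCharPair … ≠ cmTorusCharPair (conjInvChar χ₁) χ₂`):
for all intertwining maps `A : i_G(χ) → i_G(wχ)` and `B : i_G(wχ) → i_G(χ)` there is `c : ℂ` with `(B ∘ A) x = c • x` for every `x`.
Print: «THEOREM 1 (Harish-Chandra): `{U(w, λ) | w ∈ W_λ}` spans the commuting algebra» [Keys1984, §3 Thm. 1] — for `w₀χ ≠ χ` the stabiliser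
`W_χ` is trivial, so the commuting algebra of `i_G(χ)` is `ℂ`; equivalently [Casselman1995, §6.4]: `Hom_G(i(χ), i(χ)) ↪ Hom_T(r_B i(χ), χ)` and
`r_B i(χ)` has the two DISTINCT exponents `wχ`, `χ` [BernsteinZelevinsky1977, §2.12–2.13], so the Hom-space is a line.

THE MATHEMATICS (strategy: Frobenius uniqueness + the two-exponent Jacquet module; no intertwining integral, no `R`-group).  Let
`I = i_G(χ)` = ★ `cmPrincipalSeries L 3 v (cmTorusCharPair L v χ₁ χ₂)` (normalised smooth induction from the Borel ★ `cmBorelTriple L 3 v`).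
(1) ★ N1 `U3PrincipalSeriesJacquetFiltration_holds` [Casselman1995, L. 7.1.1 (a)] (through its theorem-world bridge ★ `U3PrincipalSeriesJacquetFiltration_iff`):
the normalised Jacquet module `X = r_B I` is two-dimensional with a `T`-stable LINE `ℓ` on which `T` acts by `wχ` (★ `cmWeylTorusCharPair`, which is
`cmTorusCharPair (conjInvChar χ₁) χ₂` by `rfl` — ★ `cmWeylTorusCharPair_eq`).  (2) ★ `F0P2pEigenlineFunctionals.intertwiningMap_character_eq_smul`: since
`wχ ≠ χ`, every `T`-map `X → ℂ_χ` kills `ℓ`, so `Hom_T(X, ℂ_χ)` is a line (`ψ₁ ≠ 0 ⇒ ψ₂ = c • ψ₁`).  (3) Frobenius reciprocity in uniqueness form, ★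
`F0P2pCmPrincipalSeriesInterface.intertwiningMap_cmPrincipalSeries_eq_smul` [BernsteinZelevinsky1977, Prop. 1.9 (b)] (for the smooth `π = I`, ★
`isSmooth_cmPrincipalSeries`): `Hom_T(r_B I, ℂ_χ)` a line ⇒ `Hom_G(I, I)` a line — `B₁ ≠ 0 ⇒ B₂ = c • B₁` (§1 `intertwiningMap_self_eq_smul_of_regular`).
(4) The identity of `I` is a non-zero endomorphism (`dim r_B I = 2 ⇒ I ≠ 0`, ★ `F0P2pWeylConstituentsRankOne.id_ne_zero_of_nontrivial_coinvariants`), so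
`B ∘ A = c • id` (§2 `comp_eq_smul_id_of_regular`), which is the socket read pointwise (§3 **`intertwinerCompositionScalar`** — the statement of
`sig_K2E3IntertwinerCompositionScalar` TOKEN FOR TOKEN, the Lines-side `abbrev Pl L := HeightOneSpectrum (𝓞 L⁺)` inlined; tie probe at home
`K2/K2E3-p08/g0/Probe_K2E3IntertwinerCompositionScalar.lean`: `example : type_of% @intertwinerCompositionScalar = type_of% @…U4Keys.sig_K2E3IntertwinerCompositionScalar := rfl`).

WHAT IS NOT HERE.  `dim Hom_G(i(χ), i(wχ)) ≤ 1` (socket #7 `sig_K2E3IntertwinerSpaceDimLeOne`, the same count with target `i(wχ)`), Casselman's criterion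
(#4) and Keys' list (#5, #6) — separate files of the unit; the irregular case `wχ = χ` (where `End_G(i(χ))` may be two-dimensional) is not claimed.

HONEST LABEL: HC_CM is proved only modulo the 7 printed citations (2 remaining named inputs: hLiu418 = stmt-HodgeConjecture-24832, h413 =
stmt-HodgeConjecture-24833) until rung 0 closes; this file is a `--supports stmt-HodgeConjecture-24833` helper (one socket of the K2_E3 road) and retires
nothing by itself.  Theorems only: no definition, no instance, no notation, no named fact, no `sorry`; ★-only imports (no `Cruxes/…/Lines`).

## References
* [Keys1984] D. Keys, *Principal series representations of special unitary groups over local fields*, Compositio Math. 51 (1984) 115–130, §3 Thm. 1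
  (Harish-Chandra's commuting-algebra theorem), §7 Theorem p. 126.
* [Casselman1995] W. Casselman, *Introduction to the theory of admissible representations of `p`-adic reductive groups* (draft 1 May 1995), §6.4
  pp. 62–64 (Prop. 6.4.1), §7.1 L. 7.1.1 (a) p. 67.
* [BernsteinZelevinsky1977] I. N. Bernstein, A. V. Zelevinsky, *Induced representations of reductive `p`-adic groups. I*, Ann. Sci. ÉNS (4) 10 (1977),
  Prop. 1.9 (b) (Frobenius reciprocity), §2.12 Geometrical Lemma, Cor. 2.13 (c), Thm. 2.9.
* [Rogawski1990] J. D. Rogawski, *Automorphic Representations of Unitary Groups in Three Variables*, Ann. of Math. Stud. 123 (1990), §12.1 p. 171, §12.2 p. 173.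
-/

set_option autoImplicit false
-- the mandated namespace repeats the single-problem summit's segment (`HodgeConjecture.HodgeConjecture`)
set_option linter.dupNamespace false

noncomputable section

open NumberField IsDedekindDomain MeasureTheory
open scoped Matrix

open Literature.NumberTheory Literature.NumberTheory.Automorphic Literature.NumberTheory.Automorphic.UnitaryGroup

namespace Summit.HodgeConjecture.HodgeConjecture.Cruxes.H413.K2E3IntertwinerCompositionScalar

/-! ## §1 `End_G(i_G(χ))` is a line for a regular `χ` -/

section CM

variable (L : Type) [Field L] [NumberField L] [IsCMField L] (v : HeightOneSpectrum (𝓞 ↥(maximalRealSubfield L)))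

set_option synthInstance.maxHeartbeats 400000 in
set_option maxHeartbeats 8000000 in
/-- **`End_G(i_G(χ)) = ℂ` for a REGULAR character `χ = (χ₁, χ₂)`** (`G = U(Φ₃)(L⁺_v)`, `v` non-split, `χ₁`, `χ₂` continuous, `χ ≠ wχ = (χ̄₁⁻¹, χ₂)`):
any two endomorphisms `B₁`, `B₂` of `i_G(χ)` = ★ `cmPrincipalSeries L 3 v (cmTorusCharPair L v χ₁ χ₂)` with `B₁ ≠ 0` are proportional, `B₂ = c • B₁`.
Frobenius uniqueness (★ `intertwiningMap_cmPrincipalSeries_eq_smul`) reduces this to «`Hom_T(r_B i_G(χ), ℂ_χ)` is a line», which is ★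
`intertwiningMap_character_eq_smul` on the two-dimensional Jacquet module of ★ N1 (its `wχ`-line is killed by every `T`-map to `ℂ_χ`, as `wχ ≠ χ`).
[cite: Keys1984, §3 Thm. 1] [cite: Casselman1995, §6.4 Prop. 6.4.1 p. 62; §7.1 L. 7.1.1 (a) p. 67] [cite: BernsteinZelevinsky1977, Prop. 1.9 (b); §2.12, Cor. 2.13 (c)]
[cite: Rogawski1990, §12.2 p. 173] -/
theorem intertwiningMap_self_eq_smul_of_regular
    (hns : ∀ w : PlacesOver L v, IsCMField.complexConj L • w.1 = w.1)
    (χ₁ : (LocalRing L v)ˣ →* ℂˣ) (χ₂ : ↥(normOneUnits (conjLocal L (IsCMField.complexConj L) v)) →* ℂˣ)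
    (h₁ : Continuous fun x => ((χ₁ x : ℂˣ) : ℂ)) (h₂ : Continuous fun x => ((χ₂ x : ℂˣ) : ℂ))
    (hreg : cmTorusCharPair L v χ₁ χ₂ ≠ cmTorusCharPair L v (conjInvChar (conjLocal L (IsCMField.complexConj L) v) χ₁) χ₂)
    (B₁ B₂ : (cmPrincipalSeries L 3 v (cmTorusCharPair L v χ₁ χ₂)).IntertwiningMap (cmPrincipalSeries L 3 v (cmTorusCharPair L v χ₁ χ₂)))
    (hB₁ : B₁ ≠ 0) : ∃ c : ℂ, B₂ = c • B₁ := by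
  haveI := locallyCompactSpace_cmBorelU L 3 v
  -- (1) the Jacquet module of `i_G(χ)`: two-dimensional, with the `wχ`-line `ℓ` (★ N1 through its theorem-world bridge)
  obtain ⟨hfd, hX2, ℓ, hℓ1, hline, -⟩ := (UnitaryGroup.U3PrincipalSeriesJacquetFiltration_iff L).1
    (F0P3U3PrincipalSeriesJacquetFiltrationHolds.U3PrincipalSeriesJacquetFiltration_holds L) v hns χ₁ χ₂ h₁ h₂
  -- regularity, read on the line character: `wχ ≠ χ` (`cmWeylTorusCharPair_eq` is `rfl`)
  have hne : cmWeylTorusCharPair L v χ₁ χ₂ ≠ cmTorusCharPair L v χ₁ χ₂ := by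
    rw [cmWeylTorusCharPair_eq]
    exact fun h => hreg h.symm
  haveI := hfd
  -- (2) `Hom_T(r_B i_G(χ), ℂ_χ)` is a line; (3) Frobenius uniqueness
  exact F0P2pCmPrincipalSeriesInterface.intertwiningMap_cmPrincipalSeries_eq_smul L v (cmTorusCharPair L v χ₁ χ₂)
    (cmPrincipalSeries L 3 v (cmTorusCharPair L v χ₁ χ₂)) (F0P2pCmPrincipalSeriesInterface.isSmooth_cmPrincipalSeries L v _)
    (fun ψ₁ ψ₂ hψ₁ => F0P2pEigenlineFunctionals.intertwiningMap_character_eq_smul _ hX2 (cmWeylTorusCharPair L v χ₁ χ₂)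
      (cmTorusCharPair L v χ₁ χ₂) hne ℓ hℓ1 hline ψ₁ ψ₂ hψ₁) B₁ B₂ hB₁

/-! ## §2 Compositions `i_G(χ) → i_G(wχ) → i_G(χ)` are scalar multiples of the identity -/

set_option synthInstance.maxHeartbeats 400000 in
set_option maxHeartbeats 8000000 in
/-- **`B ∘ A = c • id`** for intertwining maps `A : i_G(χ) → i_G(wχ)`, `B : i_G(wχ) → i_G(χ)` at a regular `χ` (`v` non-split, `χ₁`, `χ₂` continuous):
§1 applied to the pair (`id`, `B ∘ A`) — the identity is a non-zero endomorphism because `dim r_B i_G(χ) = 2` forces `i_G(χ) ≠ 0`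
(★ `id_ne_zero_of_nontrivial_coinvariants`).  This is the well-definedness of Keys' scalar `γ(χ)` with `J(w₀⁻¹, w₀χ) J(w₀, χ) = γ(χ)·id`.
[cite: Keys1984, §3 Thm. 1; §7 Theorem p. 126] [cite: Casselman1995, §6.4 pp. 62–64] [cite: BernsteinZelevinsky1977, Prop. 1.9 (b), Thm. 2.9] -/
theorem comp_eq_smul_id_of_regular
    (hns : ∀ w : PlacesOver L v, IsCMField.complexConj L • w.1 = w.1)
    (χ₁ : (LocalRing L v)ˣ →* ℂˣ) (χ₂ : ↥(normOneUnits (conjLocal L (IsCMField.complexConj L) v)) →* ℂˣ)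
    (h₁ : Continuous fun x => ((χ₁ x : ℂˣ) : ℂ)) (h₂ : Continuous fun x => ((χ₂ x : ℂˣ) : ℂ))
    (hreg : cmTorusCharPair L v χ₁ χ₂ ≠ cmTorusCharPair L v (conjInvChar (conjLocal L (IsCMField.complexConj L) v) χ₁) χ₂)
    (A : (cmPrincipalSeries L 3 v (cmTorusCharPair L v χ₁ χ₂)).IntertwiningMap
      (cmPrincipalSeries L 3 v (cmTorusCharPair L v (conjInvChar (conjLocal L (IsCMField.complexConj L) v) χ₁) χ₂)))
    (B : (cmPrincipalSeries L 3 v (cmTorusCharPair L v (conjInvChar (conjLocal L (IsCMField.complexConj L) v) χ₁) χ₂)).IntertwiningMap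
      (cmPrincipalSeries L 3 v (cmTorusCharPair L v χ₁ χ₂))) :
    ∃ c : ℂ, B.comp A = c • Representation.IntertwiningMap.id (cmPrincipalSeries L 3 v (cmTorusCharPair L v χ₁ χ₂)) := by
  haveI := locallyCompactSpace_cmBorelU L 3 v
  obtain ⟨-, hX2, -⟩ := (UnitaryGroup.U3PrincipalSeriesJacquetFiltration_iff L).1
    (F0P3U3PrincipalSeriesJacquetFiltrationHolds.U3PrincipalSeriesJacquetFiltration_holds L) v hns χ₁ χ₂ h₁ h₂
  have hid : Representation.IntertwiningMap.id (cmPrincipalSeries L 3 v (cmTorusCharPair L v χ₁ χ₂)) ≠ 0 :=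
    F0P2pWeylConstituentsRankOne.id_ne_zero_of_nontrivial_coinvariants (cmBorelTriple L 3 v) _ (Module.nontrivial_of_finrank_eq_succ hX2)
  exact intertwiningMap_self_eq_smul_of_regular L v hns χ₁ χ₂ h₁ h₂ hreg (Representation.IntertwiningMap.id _) (B.comp A) hid

end CM

/-! ## §3 The socket `sig_K2E3IntertwinerCompositionScalar`, token for token -/

set_option synthInstance.maxHeartbeats 400000 in
set_option maxHeartbeats 8000000 in
/-- **U4-e · `End_G(i(χ)) = ℂ` FOR REGULAR `χ`: every composition `i(χ) → i(w₀χ) → i(χ)` is a scalar** — the statement of the socket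
`K2E3EllipticInputs.U4Keys.sig_K2E3IntertwinerCompositionScalar` TOKEN FOR TOKEN (the Lines-side `abbrev Pl L := HeightOneSpectrum (𝓞 L⁺)` inlined):
for a CM field `L`, a finite place `v` of `L⁺` non-split in `L`, continuous `χ₁`, `χ₂` with `(χ₁, χ₂) ≠ w(χ₁, χ₂) = (χ̄₁⁻¹, χ₂)`, and intertwining maps
`A : i_G(χ₁, χ₂) → i_G(χ̄₁⁻¹, χ₂)`, `B : i_G(χ̄₁⁻¹, χ₂) → i_G(χ₁, χ₂)`, there is `c : ℂ` with `(B ∘ A) x = c • x` for all `x` (§2 read pointwise).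
(Even when `i(χ)` is reducible — then indecomposable of length two with non-isomorphic constituents — its endomorphism algebra is `ℂ`, because
`Hom_G(i(χ), i(χ)) ↪ Hom_T(r_N i(χ), χδ^{1∕2})` is one-dimensional for `w₀χ ≠ χ`.)  With U4-d this makes Keys' `γ(χ)` well defined.
[cite: Casselman1995, §6.4] [cite: BernsteinZelevinsky1977, §2] [cite: Keys1984, §3 Thm. 1] [cite: Rogawski1990, §12.2 p. 173] -/
theorem intertwinerCompositionScalar :
  ∀ (L : Type) [Field L] [NumberField L] [IsCMField L] (v : HeightOneSpectrum (𝓞 ↥(maximalRealSubfield L))),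
    (∀ w : PlacesOver L v, IsCMField.complexConj L • w.1 = w.1) →
    ∀ (χ₁ : (UnitaryGroup.LocalRing L v)ˣ →* ℂˣ) (χ₂ : ↥(normOneUnits (conjLocal L (IsCMField.complexConj L) v)) →* ℂˣ), Continuous (fun x => ((χ₁ x : ℂˣ) : ℂ)) → Continuous (fun x => ((χ₂ x : ℂˣ) : ℂ)) → UnitaryGroup.cmTorusCharPair L v χ₁ χ₂ ≠ UnitaryGroup.cmTorusCharPair L v (UnitaryGroup.conjInvChar (conjLocal L (IsCMField.complexConj L) v) χ₁) χ₂ →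
      ∀ (A : (UnitaryGroup.cmPrincipalSeries L 3 v (UnitaryGroup.cmTorusCharPair L v χ₁ χ₂)).IntertwiningMap (UnitaryGroup.cmPrincipalSeries L 3 v (UnitaryGroup.cmTorusCharPair L v (UnitaryGroup.conjInvChar (conjLocal L (IsCMField.complexConj L) v) χ₁) χ₂))) (B : (UnitaryGroup.cmPrincipalSeries L 3 v (UnitaryGroup.cmTorusCharPair L v (UnitaryGroup.conjInvChar (conjLocal L (IsCMField.complexConj L) v) χ₁) χ₂)).IntertwiningMap (UnitaryGroup.cmPrincipalSeries L 3 v (UnitaryGroup.cmTorusCharPair L v χ₁ χ₂))), ∃ c : ℂ, ∀ x, (B.comp A).toLinearMap x = c • x := by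
  intro L _ _ _ v hns χ₁ χ₂ h₁ h₂ hreg A B
  obtain ⟨c, hc⟩ := comp_eq_smul_id_of_regular L v hns χ₁ χ₂ h₁ h₂ hreg A B
  refine ⟨c, fun x => ?_⟩
  have h := congrArg (fun T : Representation.IntertwiningMap _ _ => T x) hc
  simpa [Representation.IntertwiningMap.comp_apply, Representation.IntertwiningMap.smul_apply] using h

end Summit.HodgeConjecture.HodgeConjecture.Cruxes.H413.K2E3IntertwinerCompositionScalar

end
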